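import Literature.Probability.LatticeModels.StarComponents
import Literature.Probability.LatticeModels.StarLatticeBox
import Literature.Combinatorics.SimpleGraph.CycleSpaceSeparatorsRelative
import HarnessLib

/-!
# Lemma B.82 inside a box: `★`-boundaries relative to a box are `★`-connected

Topic `Literature/Probability/LatticeModels`. `StarBoundary.lean` proves Friedli–Velenik's
Lemma B.82 for a finite `★`-connected set `A ⊂ ℤ^d` with `★`-connected complement IN `ℤ^d`. Contour
arguments inside a finite box `Λ = Icc lo hi` (Peierls estimates for a cluster grown inside `Λ`, free
boundary conditions) need the RELATIVE version, in which the complement is taken inside `Λ` and only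
`★`-neighbours inside `Λ` count:

> **Lemma B.82 in a box.** Let `A ⊆ Λ` with `A` and `Λ ∖ A` both `★`-connected. Then
> `∂^ex_Λ A := {y ∈ Λ ∖ A : y ★-adjacent to A}` and `∂^in_Λ A := {x ∈ A : x ★-adjacent to Λ ∖ A}`
> are `★`-connected.

This does not follow formally from the absolute statement (the complement of `A` in `ℤ^d` need not
be `★`-connected, and `∂^ex A` may be connected only through points outside `Λ`); it is Lemma B.82 for
the `★`-graph INDUCED on `Λ`, proved exactly as in the book from Lemma B.83 for that graph
(`exists_generator_crossing_both_rel`, with `V = Λ`) and Lemma B.81 for the `★`-triangles of the box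
(`inSpan_starTriangles_box`): across a splitting of the boundary with no `★`-edge between the classes,
one `★`-triangle of the box would carry boundary edges of both classes, whose picked endpoints are
distinct vertices of the triangle, hence `★`-adjacent.

* `starConn_boundary_pick_box` — the two-in-one form (`pick a b ∈ {a, b}` over the boundary
  `★`-edges `ab`, `a ∈ A`, `b ∈ Λ ∖ A`);
* `starConn_exBoundary_box`, `starConn_inBoundary_box` — `∂^ex_Λ A = ∂^ex A ∩ Λ` and `∂^in_Λ A`;
* `reflTransGen_starRel_Icc` — a box is `★`-connected;
* `starConn_sdiff_of_starComponent_box`, `starConn_boundary_pick_box_of_starComponent` — the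
  COMPONENTS form (the one contour arguments consume, cf. Deuschel–Pisztora 1996, Lemma 2.1 (ii),
  stated there for the nearest-neighbour boundaries): if `K ⊆ Λ` is `★`-connected and `A` is a
  `★`-component of `Λ ∖ K`, then `Λ ∖ A` is `★`-connected, so the relative `★`-boundaries of `A`
  are `★`-connected with no hypothesis on the complement to discharge.

Everything is proved; no named facts and no new definitions.

## References

* S. Friedli, Y. Velenik, *Statistical Mechanics of Lattice Systems*, CUP 2017, App. B.15,
  Lemmas B.81–B.83; §7.2.6. [FriedliVelenik2017]
* Á. Timár, *Boundary-connectivity via graph theory*, Proc. Amer. Math. Soc. 141 (2013) 475–480,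
  Theorem 3 (arbitrary graphs; here the `★`-graph induced on a box). [Timar2013]
* J.-D. Deuschel, Á. Pisztora, *Surface order large deviations for high-density percolation*,
  Probab. Theory Related Fields 104 (1996) 467–482, Lemma 2.1 (ii), p. 471 (boundaries, inside a
  finite box `B`, of the components in `B` of `B ∖ Λ` for `★`-connected `Λ`). [DeuschelPisztora1996]
-/

noncomputable section

open Finset SimpleGraph Relation
open Literature.Combinatorics.SimpleGraph.CycleSpace

namespace Literature.Probability.LatticeModels

variable {d : ℕ}

/-- **Lemma B.82 in a box, two-in-one form.** Let `A ⊆ Λ = Icc lo hi` with `A` and `Λ ∖ A`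
`★`-connected, and choose for every pair an endpoint `pick a b ∈ {a, b}`. Then the set of points
`pick a b` over the boundary `★`-edges `ab` with `a ∈ A`, `b ∈ Λ ∖ A` is `★`-connected (for
`pick a b = b` this is `∂^ex_Λ A`, for `pick a b = a` it is `∂^in_Λ A`). Proof as for
`starConn_boundary_pick` with Lemma B.83 relative to `V = Λ` and the `★`-triangles of the box as
generators. [cite: FriedliVelenik2017, App. B.15, Lemma B.82 (proof via Lemmas B.81, B.83); Timar2013, Theorem 3] -/
theorem starConn_boundary_pick_box {lo hi : Site d} {A : Finset (Site d)} (hAV : A ⊆ Finset.Icc lo hi)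
    (hA : StarConn (A : Set (Site d)))
    (hAc : StarConn ((↑(Finset.Icc lo hi) : Set (Site d)) \ ↑A))
    (pick : Site d → Site d → Site d) (hpick : ∀ a b, pick a b = a ∨ pick a b = b) :
    StarConn {z | ∃ a b, a ∈ A ∧ b ∈ Finset.Icc lo hi ∧ b ∉ A ∧ (zdStar d).Adj a b ∧ pick a b = z} := by
  classical
  set Λ : Finset (Site d) := Finset.Icc lo hi with hΛ
  set P : Set (Site d) := {z | ∃ a b, a ∈ A ∧ b ∈ Λ ∧ b ∉ A ∧ (zdStar d).Adj a b ∧ pick a b = z} with hP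
  intro x hx y hy
  by_contra hxy
  obtain ⟨ax, bx, hax, hbxΛ, hbx, hadjx, hpx⟩ := hx
  obtain ⟨ay, cy, hay, hcyΛ, hcy, hadjy, hpy⟩ := hy
  -- the boundary `★`-edges inside the box
  set E : Finset (Sym2 (Site d)) :=
    A.biUnion fun a => ((starBall a).filter fun b => b ∉ A ∧ b ∈ Λ).image fun b => s(a, b) with hE'
  have hE : ∀ e, e ∈ E ↔ ∃ a b, a ∈ A ∧ b ∈ Λ ∧ b ∉ A ∧ (zdStar d).Adj a b ∧ e = s(a, b) := by
    intro e
    simp only [hE', mem_biUnion, mem_image, mem_filter]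
    constructor
    · rintro ⟨a, ha, b, ⟨hb, hbA, hbΛ⟩, rfl⟩
      exact ⟨a, b, ha, hbΛ, hbA, adj_iff_mem_starBall.2 ⟨hb, fun h => hbA (h ▸ ha)⟩, rfl⟩
    · rintro ⟨a, b, ha, hbΛ, hbA, hadj, rfl⟩
      exact ⟨a, ha, b, ⟨(adj_iff_mem_starBall.1 hadj).1, hbA, hbΛ⟩, rfl⟩
  -- a boundary edge has a unique orientation from `A` to `Λ ∖ A`
  have horient : ∀ a b a' b', a ∈ A → b ∉ A → a' ∈ A → b' ∉ A → s(a, b) = s(a', b') → a = a' ∧ b = b' := by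
    intro a b a' b' ha hb ha' hb' h
    rcases Sym2.eq_iff.1 h with ⟨h1, h2⟩ | ⟨h1, h2⟩
    · exact ⟨h1, h2⟩
    · exact absurd (h1 ▸ ha) hb'
  -- the class of `x` and the induced splitting of the boundary edges
  set P₁ : Set (Site d) := {z | ReflTransGen (starRel P) x z} with hP₁
  set E₁ : Finset (Sym2 (Site d)) :=
    E.filter fun e => ∃ a b, a ∈ A ∧ b ∉ A ∧ e = s(a, b) ∧ pick a b ∈ P₁ with hE₁
  set E₂ : Finset (Sym2 (Site d)) :=
    E.filter fun e => ∃ a b, a ∈ A ∧ b ∉ A ∧ e = s(a, b) ∧ pick a b ∉ P₁ with hE₂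
  -- connectivity in walk form: inside `A`, and inside `Λ ∖ A`
  have hA' : ∀ a ∈ A, ∀ a' ∈ A, ∃ p : (zdStar d).Walk a a', ∀ w ∈ p.support, w ∈ A := by
    intro a ha a' ha'
    obtain ⟨p, hp⟩ := exists_walk_of_reflTransGen (hA a (mem_coe.2 ha) a' (mem_coe.2 ha')) (mem_coe.2 ha)
    exact ⟨p, fun w hw => mem_coe.1 (hp w hw)⟩
  have hAc' : ∀ b ∈ (↑Λ : Set (Site d)), b ∉ A → ∀ b' ∈ (↑Λ : Set (Site d)), b' ∉ A →
      ∃ p : (zdStar d).Walk b b', ∀ w ∈ p.support, w ∈ (↑Λ : Set (Site d)) ∧ w ∉ A := by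
    intro b hb hbA b' hb' hb'A
    have hb1 : b ∈ (↑Λ : Set (Site d)) \ ↑A := ⟨hb, fun h => hbA (mem_coe.1 h)⟩
    have hb1' : b' ∈ (↑Λ : Set (Site d)) \ ↑A := ⟨hb', fun h => hb'A (mem_coe.1 h)⟩
    obtain ⟨p, hp⟩ := exists_walk_of_reflTransGen (hAc b hb1 b' hb1') hb1
    exact ⟨p, fun w hw => ⟨(hp w hw).1, fun h => (hp w hw).2 (mem_coe.2 h)⟩⟩
  -- the splitting is a partition of the `★`-edges inside `Λ` crossing `A`
  have hEpart : ∀ e, e ∈ E₁ ∨ e ∈ E₂ ↔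
      e ∈ (zdStar d).edgeSet ∧ (∀ v ∈ e, v ∈ (↑Λ : Set (Site d))) ∧ Crosses A e := by
    intro e
    constructor
    · rintro (h | h)
      · obtain ⟨a, b, ha, hbΛ, hb, hadj, rfl⟩ := (hE e).1 (mem_filter.1 h).1
        refine ⟨(mem_edgeSet _).2 hadj, fun v hv => ?_, (crosses_mk A a b).2 (Or.inl ⟨ha, hb⟩)⟩
        rcases Sym2.mem_iff.1 hv with rfl | rfl
        · exact mem_coe.2 (hAV ha)
        · exact mem_coe.2 hbΛ
      · obtain ⟨a, b, ha, hbΛ, hb, hadj, rfl⟩ := (hE e).1 (mem_filter.1 h).1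
        refine ⟨(mem_edgeSet _).2 hadj, fun v hv => ?_, (crosses_mk A a b).2 (Or.inl ⟨ha, hb⟩)⟩
        rcases Sym2.mem_iff.1 hv with rfl | rfl
        · exact mem_coe.2 (hAV ha)
        · exact mem_coe.2 hbΛ
    · rintro ⟨hedge, hΛe, hcr⟩
      obtain ⟨a, b, ha, hbΛ, hb, hadj, rfl⟩ :
          ∃ a b, a ∈ A ∧ b ∈ Λ ∧ b ∉ A ∧ (zdStar d).Adj a b ∧ e = s(a, b) := by
        revert hedge hcr hΛe
        induction e using Sym2.ind with
        | h u v =>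
          intro hedge hΛe hcr
          rw [crosses_mk] at hcr
          rw [mem_edgeSet] at hedge
          rcases hcr with ⟨hu, hv⟩ | ⟨hu, hv⟩
          · exact ⟨u, v, hu, mem_coe.1 (hΛe v (Sym2.mem_mk_right u v)), hv, hedge, rfl⟩
          · exact ⟨v, u, hv, mem_coe.1 (hΛe u (Sym2.mem_mk_left u v)), hu, hedge.symm, Sym2.eq_swap⟩
      have heE : s(a, b) ∈ E := (hE _).2 ⟨a, b, ha, hbΛ, hb, hadj, rfl⟩
      by_cases hp : pick a b ∈ P₁
      · exact Or.inl (mem_filter.2 ⟨heE, a, b, ha, hb, rfl, hp⟩)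
      · exact Or.inr (mem_filter.2 ⟨heE, a, b, ha, hb, rfl, hp⟩)
  have hdisj : Disjoint E₁ E₂ := by
    rw [Finset.disjoint_left]
    intro e h1 h2
    obtain ⟨-, a, b, ha, hb, rfl, hp⟩ := mem_filter.1 h1
    obtain ⟨-, a', b', ha', hb', heq, hp'⟩ := mem_filter.1 h2
    obtain ⟨rfl, rfl⟩ := horient a b a' b' ha hb ha' hb' heq
    exact hp' hp
  have h1ne : E₁.Nonempty :=
    ⟨s(ax, bx), mem_filter.2 ⟨(hE _).2 ⟨ax, bx, hax, hbxΛ, hbx, hadjx, rfl⟩, ax, bx, hax, hbx, rfl, by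
      rw [hpx]; exact ReflTransGen.refl⟩⟩
  have h2ne : E₂.Nonempty :=
    ⟨s(ay, cy), mem_filter.2 ⟨(hE _).2 ⟨ay, cy, hay, hcyΛ, hcy, hadjy, rfl⟩, ay, cy, hay, hcy, rfl, by
      rw [hpy]; exact hxy⟩⟩
  -- Lemma B.83 for the `★`-graph induced on `Λ`: one triangle of the box meets both classes
  obtain ⟨T, hT, ⟨e₁, he₁T, he₁⟩, ⟨e₂, he₂T, he₂⟩⟩ :=
    exists_generator_crossing_both_rel (G := zdStar d) (V := (↑Λ : Set (Site d)))
      (𝒞 := {T | T ∈ starTriangles d ∧ ∀ e ∈ T, ∀ x ∈ e, x ∈ Λ})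
      (fun Z hZ heven => inSpan_starTriangles_box (fun e he => (hZ e he).1) heven
        (fun e he v hv => mem_coe.1 ((hZ e he).2 v hv)))
      (fun C hC => (starTriangles_box_even_edge hC).1)
      (fun C hC e he => ⟨((starTriangles_box_even_edge hC).2 e he).1,
        fun v hv => mem_coe.2 (((starTriangles_box_even_edge hC).2 e he).2 v hv)⟩)
      (fun a ha => mem_coe.2 (hAV ha)) hA' hAc' hEpart h1ne h2ne hdisj
  obtain ⟨he₁E, a₁, b₁, ha₁, hb₁, rfl, hp₁⟩ := mem_filter.1 he₁
  obtain ⟨he₂E, a₂, b₂, ha₂, hb₂, rfl, hp₂⟩ := mem_filter.1 he₂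
  have hadj₁ : (zdStar d).Adj a₁ b₁ ∧ b₁ ∈ Λ := by
    obtain ⟨a, b, ha, hbΛ, hb, hadj, heq⟩ := (hE _).1 he₁E
    obtain ⟨rfl, rfl⟩ := horient _ _ _ _ ha₁ hb₁ ha hb heq
    exact ⟨hadj, hbΛ⟩
  have hadj₂ : (zdStar d).Adj a₂ b₂ ∧ b₂ ∈ Λ := by
    obtain ⟨a, b, ha, hbΛ, hb, hadj, heq⟩ := (hE _).1 he₂E
    obtain ⟨rfl, rfl⟩ := horient _ _ _ _ ha₂ hb₂ ha hb heq
    exact ⟨hadj, hbΛ⟩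
  -- the two picked endpoints are distinct vertices of `T`, hence adjacent
  have hv₁ : pick a₁ b₁ ∈ s(a₁, b₁) := by
    rcases hpick a₁ b₁ with h | h <;> rw [h]
    · exact Sym2.mem_mk_left _ _
    · exact Sym2.mem_mk_right _ _
  have hv₂ : pick a₂ b₂ ∈ s(a₂, b₂) := by
    rcases hpick a₂ b₂ with h | h <;> rw [h]
    · exact Sym2.mem_mk_left _ _
    · exact Sym2.mem_mk_right _ _
  have hne : pick a₁ b₁ ≠ pick a₂ b₂ := fun h => hp₂ (h ▸ hp₁)
  have hadj12 := adj_of_mem_starTriangle hT.1 he₁T hv₁ he₂T hv₂ hne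
  have hP1 : pick a₁ b₁ ∈ P := ⟨a₁, b₁, ha₁, hadj₁.2, hb₁, hadj₁.1, rfl⟩
  have hP2 : pick a₂ b₂ ∈ P := ⟨a₂, b₂, ha₂, hadj₂.2, hb₂, hadj₂.1, rfl⟩
  exact hp₂ (ReflTransGen.tail hp₁ ⟨hadj12, hP1, hP2⟩)

/-- **Lemma B.82 in a box, exterior boundary.** If `A ⊆ Λ = Icc lo hi` and both `A` and `Λ ∖ A` are
`★`-connected, then `∂^ex_Λ A = ∂^ex A ∩ Λ` (the points of `Λ ∖ A` that are `★`-adjacent to `A`) is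
`★`-connected. [cite: FriedliVelenik2017, App. B.15, Lemma B.82; Timar2013, Theorem 3] -/
theorem starConn_exBoundary_box {lo hi : Site d} {A : Finset (Site d)} (hAV : A ⊆ Finset.Icc lo hi)
    (hA : StarConn (A : Set (Site d))) (hAc : StarConn ((↑(Finset.Icc lo hi) : Set (Site d)) \ ↑A)) :
    StarConn ((exBoundary A ∩ Finset.Icc lo hi : Finset (Site d)) : Set (Site d)) := by
  have h := starConn_boundary_pick_box hAV hA hAc (fun _ b => b) (fun _ _ => Or.inr rfl)
  have hset : ((exBoundary A ∩ Finset.Icc lo hi : Finset (Site d)) : Set (Site d)) =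
      {z | ∃ a b, a ∈ A ∧ b ∈ Finset.Icc lo hi ∧ b ∉ A ∧ (zdStar d).Adj a b ∧ b = z} := by
    ext z
    simp only [mem_coe, mem_inter, mem_exBoundary, Set.mem_setOf_eq]
    constructor
    · rintro ⟨⟨hz, a, ha, hadj⟩, hzΛ⟩; exact ⟨a, z, ha, hzΛ, hz, hadj, rfl⟩
    · rintro ⟨a, b, ha, hbΛ, hb, hadj, rfl⟩; exact ⟨⟨hb, a, ha, hadj⟩, hbΛ⟩
  rw [hset]; exact h

/-- **Lemma B.82 in a box, interior boundary.** If `A ⊆ Λ = Icc lo hi` and both `A` and `Λ ∖ A` are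
`★`-connected, then `∂^in_Λ A` (the points of `A` that are `★`-adjacent to `Λ ∖ A`) is `★`-connected.
[cite: FriedliVelenik2017, App. B.15, Lemma B.82; Timar2013, Theorem 3] -/
theorem starConn_inBoundary_box {lo hi : Site d} {A : Finset (Site d)} (hAV : A ⊆ Finset.Icc lo hi)
    (hA : StarConn (A : Set (Site d))) (hAc : StarConn ((↑(Finset.Icc lo hi) : Set (Site d)) \ ↑A)) :
    StarConn {x | x ∈ A ∧ ∃ y ∈ Finset.Icc lo hi, y ∉ A ∧ (zdStar d).Adj x y} := by
  have h := starConn_boundary_pick_box hAV hA hAc (fun a _ => a) (fun _ _ => Or.inl rfl)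
  have hset : {x | x ∈ A ∧ ∃ y ∈ Finset.Icc lo hi, y ∉ A ∧ (zdStar d).Adj x y} =
      {z | ∃ a b, a ∈ A ∧ b ∈ Finset.Icc lo hi ∧ b ∉ A ∧ (zdStar d).Adj a b ∧ a = z} := by
    ext z
    simp only [Set.mem_setOf_eq]
    constructor
    · rintro ⟨hz, b, hbΛ, hb, hadj⟩; exact ⟨z, b, hz, hbΛ, hb, hadj, rfl⟩
    · rintro ⟨a, b, ha, hbΛ, hb, hadj, rfl⟩; exact ⟨ha, b, hbΛ, hb, hadj⟩
  rw [hset]; exact h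

/-! ### The components form -/

/-- **A coordinate box is `★`-connected**: any two points of `Icc lo hi` are joined by a chain of
`★`-adjacent points of the box (move one coordinate at a time; intermediate points stay in the box).
[cite: FriedliVelenik2017, §7.2.6 (connectedness for d_∞)] -/
theorem reflTransGen_starRel_Icc {lo hi x y : Site d} (hx : x ∈ Finset.Icc lo hi) (hy : y ∈ Finset.Icc lo hi) :
    ReflTransGen (starRel (↑(Finset.Icc lo hi) : Set (Site d))) x y := by
  classical
  suffices key : ∀ (n : ℕ) (z : Site d), z ∈ Finset.Icc lo hi → #(univ.filter fun k => z k ≠ y k) ≤ n →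
      ReflTransGen (starRel (↑(Finset.Icc lo hi) : Set (Site d))) z y from
    key d x hx ((card_filter_le _ _).trans (by simp))
  intro n
  induction n with
  | zero =>
    intro z _ hn
    have : z = y := funext fun k => by
      by_contra hk
      have : 0 < #(univ.filter fun k => z k ≠ y k) := card_pos.2 ⟨k, mem_filter.2 ⟨mem_univ k, hk⟩⟩
      omega
    subst this
    exact ReflTransGen.refl
  | succ n ih =>
    intro z hz hn
    by_cases hall : ∀ k, z k = y k
    · rw [show z = y from funext hall]
    · push Not at hall
      obtain ⟨k, hk⟩ := hall
      rw [Finset.mem_Icc] at hz hy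
      -- the segment from `z` to `update z k (y k)` stays in the box
      have hline : ∀ w : ℤ, min (z k) (y k) ≤ w → w ≤ max (z k) (y k) →
          Function.update z k w ∈ (↑(Finset.Icc lo hi) : Set (Site d)) := by
        intro w hw1 hw2
        rw [mem_coe, Finset.mem_Icc]
        refine ⟨Pi.le_def.2 fun j => ?_, Pi.le_def.2 fun j => ?_⟩
        · by_cases hj : j = k
          · rw [hj, Function.update_self]
            have h1 : lo k ≤ z k := hz.1 k
            have h2 : lo k ≤ y k := hy.1 k
            omega
          · rw [Function.update_of_ne hj]; exact hz.1 j
        · by_cases hj : j = k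
          · rw [hj, Function.update_self]
            have h1 : z k ≤ hi k := hz.2 k
            have h2 : y k ≤ hi k := hy.2 k
            omega
          · rw [Function.update_of_ne hj]; exact hz.2 j
      have hmove : ReflTransGen (starRel (↑(Finset.Icc lo hi) : Set (Site d))) z (Function.update z k (y k)) := by
        rcases le_or_gt (z k) (y k) with hle | hlt
        · obtain ⟨m, hm⟩ := Int.le.dest hle
          rw [← hm]
          exact reflTransGen_update_add z k m fun m' hm' => hline _ (by omega) (by omega)
        · obtain ⟨m, hm⟩ := Int.le.dest hlt.le
          rw [show y k = z k - m by omega]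
          exact reflTransGen_update_sub z k m fun m' hm' => hline _ (by omega) (by omega)
      have hz' : Function.update z k (y k) ∈ Finset.Icc lo hi :=
        mem_coe.1 (hline (y k) (min_le_right _ _) (le_max_right _ _))
      refine hmove.trans (ih _ hz' ?_)
      have hset : (univ.filter fun k' => Function.update z k (y k) k' ≠ y k') =
          (univ.filter fun k' => z k' ≠ y k').erase k := by
        ext k'
        simp only [mem_filter, mem_univ, true_and, mem_erase]
        by_cases hk' : k' = k
        · subst hk'; simp
        · rw [Function.update_of_ne hk']; tauto
      rw [hset, card_erase_of_mem (mem_filter.2 ⟨mem_univ k, hk⟩)]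
      omega

/-- **The complement in a box of a `★`-component is `★`-connected.** Let `K ⊆ Λ = Icc lo hi` be
`★`-connected and let `A ⊆ Λ ∖ K` be `★`-connected and closed under `★`-steps inside `Λ ∖ K` (a
`★`-component of `Λ ∖ K`). Then `Λ ∖ A` is `★`-connected: from any point of `Λ ∖ A` a chain inside the
box reaches `K` before it can enter `A` (the point before the first point of `A` would lie in `A`),
and `K` is `★`-connected. (Friedli–Velenik, Exercise 7.11, inside a box; the situation of
Deuschel–Pisztora's Lemma 2.1 (ii).) [cite: FriedliVelenik2017, §7.2.6, Exercise 7.11; DeuschelPisztora1996, Lemma 2.1 (ii) (p. 471)] -/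
theorem starConn_sdiff_of_starComponent_box {lo hi : Site d} {K A : Finset (Site d)}
    (hKV : K ⊆ Finset.Icc lo hi) (hK : StarConn (K : Set (Site d))) (hAK : Disjoint A K)
    (hmax : ∀ x ∈ Finset.Icc lo hi, x ∉ K → ∀ a ∈ A, (zdStar d).Adj a x → x ∈ A) :
    StarConn ((↑(Finset.Icc lo hi) : Set (Site d)) \ ↑A) := by
  classical
  set Λ : Finset (Site d) := Finset.Icc lo hi with hΛ
  set V : Set (Site d) := (↑Λ : Set (Site d)) \ ↑A with hV
  have hKV' : (K : Set (Site d)) ⊆ V := fun z hz =>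
    ⟨mem_coe.2 (hKV (mem_coe.1 hz)), fun hzA => Finset.disjoint_left.1 hAK (mem_coe.1 hzA) (mem_coe.1 hz)⟩
  -- walking inside the box from a point of `V`: we stay in `V` until we reach the target or `K`
  have hit : ∀ (u w : Site d), ReflTransGen (starRel (↑Λ : Set (Site d))) u w → u ∈ V →
      ∃ z, ReflTransGen (starRel V) u z ∧ (z = w ∨ z ∈ K) := by
    intro u w huw
    refine ReflTransGen.head_induction_on huw (fun _ => ⟨w, ReflTransGen.refl, Or.inl rfl⟩) ?_
    intro a c hac _ ih ha
    by_cases haK : a ∈ K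
    · exact ⟨a, ReflTransGen.refl, Or.inr haK⟩
    · have hcA : c ∉ A := fun hcA =>
        ha.2 (mem_coe.2 (hmax a (mem_coe.1 hac.2.1) haK c hcA hac.1.symm))
      have hc : c ∈ V := ⟨hac.2.2, fun h => hcA (mem_coe.1 h)⟩
      obtain ⟨z, hcz, hz⟩ := ih hc
      exact ⟨z, ReflTransGen.head ⟨hac.1, ha, hc⟩ hcz, hz⟩
  -- every point of `V` is chained inside `V` to a point of `K`, or `V`-chained to any other point
  intro u hu v hv
  obtain ⟨z, huz, hz⟩ := hit u v (reflTransGen_starRel_Icc (mem_coe.1 hu.1) (mem_coe.1 hv.1)) hu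
  rcases hz with rfl | hzK
  · exact huz
  obtain ⟨z', hvz', hz'⟩ := hit v u (reflTransGen_starRel_Icc (mem_coe.1 hv.1) (mem_coe.1 hu.1)) hv
  rcases hz' with rfl | hz'K
  · exact reflTransGen_starRel_symm hvz'
  exact (huz.trans (reflTransGen_starRel_mono hKV' (hK z (mem_coe.2 hzK) z' (mem_coe.2 hz'K)))).trans
    (reflTransGen_starRel_symm hvz')

/-- **Lemma B.82 in a box, components form** (the form used by contour arguments; cf.
Deuschel–Pisztora 1996, Lemma 2.1 (ii) for the nearest-neighbour boundaries). Let `K ⊆ Λ = Icc lo hi`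
be `★`-connected and `A` a `★`-component of `Λ ∖ K` (`★`-connected, disjoint from `K`, closed under
`★`-steps inside `Λ ∖ K`). Then for every endpoint choice `pick a b ∈ {a, b}` the picked endpoints of
the `★`-edges `ab`, `a ∈ A`, `b ∈ Λ ∖ A`, form a `★`-connected set — in particular the relative
boundaries `∂^ex_Λ A ⊆ K` and `∂^in_Λ A` are `★`-connected (`starConn_exBoundary_box`,
`starConn_inBoundary_box` with `starConn_sdiff_of_starComponent_box`).
[cite: FriedliVelenik2017, App. B.15, Lemma B.82 with §7.2.6 Exercise 7.11; DeuschelPisztora1996, Lemma 2.1 (ii) (p. 471)] -/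
theorem starConn_boundary_pick_box_of_starComponent {lo hi : Site d} {K A : Finset (Site d)}
    (hKV : K ⊆ Finset.Icc lo hi) (hK : StarConn (K : Set (Site d)))
    (hAV : A ⊆ Finset.Icc lo hi) (hAK : Disjoint A K) (hA : StarConn (A : Set (Site d)))
    (hmax : ∀ x ∈ Finset.Icc lo hi, x ∉ K → ∀ a ∈ A, (zdStar d).Adj a x → x ∈ A)
    (pick : Site d → Site d → Site d) (hpick : ∀ a b, pick a b = a ∨ pick a b = b) :
    StarConn {z | ∃ a b, a ∈ A ∧ b ∈ Finset.Icc lo hi ∧ b ∉ A ∧ (zdStar d).Adj a b ∧ pick a b = z} :=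
  starConn_boundary_pick_box hAV hA (starConn_sdiff_of_starComponent_box hKV hK hAK hmax) pick hpick

end Literature.Probability.LatticeModels

end
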